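import Summits.ResolutionOfSingularities.ResolutionOfSingularities.Theorems.FrobeniusLadderFRationalResolutionUnitChart
import Summits.ResolutionOfSingularities.ResolutionOfSingularities.Theorems.FrobeniusLadderFRationalResolutionKernelLattice
import Mathlib.LinearAlgebra.Dimension.Localization
import HarnessLib

/-!
# Crux `FrobeniusLadder.FRationalResolution` (stmt-ResolutionOfSingularities-15317), line `redirect`,
# stub `stub_diagonalizableQuotientResolution` — the RANK TERM of Kato's (2.1)(ii) for the
# unit-exponent chart: `(n + r) − rk F_ψ(ι⁻¹𝔮)ᵍᵖ = n − rk F_φ(𝔮)ᵍᵖ` (brick W3' of memo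
# MEMO-15317-leafhand2-g4 §2bis, rank bookkeeping)

Setting of `…UnitChart`: `φ(m) = x^m` on `P ⊆ ℤⁿ` into `T = S'_0`, `ψ(m, e) = x^m u^e` on
`P₀ ⊆ ℤ^{n+r}` into `S₀`, units `uⱼ` of degrees `bⱼ` (of finite order) exhausting `ker f`. For a
prime `𝔮` of `T` the faces satisfy `F_ψ = π⁻¹ F_φ` for the projection `π : ℤ^{n+r} → ℤⁿ`
(`…UnitChart.mem_face_iff`), `π` maps `⟨F_ψ⟩` onto `⟨F_φ⟩` (lifting), and the kernel of `π` on
`⟨F_ψ⟩` is `0 × ker(e ↦ Σ eⱼ bⱼ)`, a lattice of rank `r` (`…KernelLattice`); rank–nullity over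
`ℤ` gives `rk ⟨F_ψ⟩ = rk ⟨F_φ⟩ + r`.

* `span_face_le_ker` — `⟨F_ψ⟩ ≤ ker(v ↦ Σ v_l (a,b)_l)`;
* `append_zero_mem_span_face` — `(0, e) ∈ ⟨F_ψ⟩` for `e ∈ ker(e ↦ Σ eⱼ bⱼ)`;
* **`finrank_span_face_eq`** — `rk ⟨F_ψ(ι⁻¹𝔮)⟩ = rk ⟨F_φ(𝔮)⟩ + r`;
* **`rank_term_eq`** — `(n + r) − rk ⟨F_ψ⟩ = n − rk ⟨F_φ⟩`, the hypothesis of `…LogRegularDescent`.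

Honest label: bookkeeping brick of the wild non-fixed route (no stub closed). No definitions, no
named facts, no sorry. [cite: Kato1994, Def. (2.1)] [folklore]
-/

noncomputable section

-- single-problem summit: the doubled namespace component is forced
set_option linter.dupNamespace false

open DirectSum Literature.AlgebraicGeometry.Resolution

namespace Summit.ResolutionOfSingularities.ResolutionOfSingularities.Theorems.FRationalResolution.UnitChartRank

universe u w w'

variable {k : Type u} [Field k] {A : Type w} [DecidableEq A] [AddCommGroup A] {S : Type u}
  [CommRing S] [Algebra k S] (𝒮 : A → Submodule k S) [GradedAlgebra 𝒮]
  {A' : Type w'} [DecidableEq A'] [AddCommGroup A'] (f : A →+ A') (𝒮' : A' → Submodule k S)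
  [GradedAlgebra 𝒮'] (hle : ∀ a, 𝒮 a ≤ 𝒮' (f a)) (ι : 𝒮 0 →+* 𝒮' 0) (hι : ∀ s, (ι s : S) = s)
  {n r : ℕ} {x : Fin n → S} {a : Fin n → A} {u : Fin r → S} {b : Fin r → A}
  (hu : ∀ j, u j ∈ 𝒮 (b j)) (huu : ∀ j, IsUnit (u j)) (hb : ∀ j, f (b j) = 0)
  (P : AddSubmonoid (Fin n → ℤ))
  (hP : ∀ m, m ∈ P ↔ 0 ≤ m ∧ Fintype.linearCombination ℤ (fun i => f (a i)) m = 0)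
  (P₀ : AddSubmonoid (Fin (n + r) → ℤ))
  (hP₀ : ∀ v, v ∈ P₀ ↔ 0 ≤ v ∧ Fintype.linearCombination ℤ (Fin.append a b) v = 0)
  (φ : Multiplicative P →* 𝒮' 0)
  (hφ : ∀ m : P, ((φ (Multiplicative.ofAdd m) : 𝒮' 0) : S) =
    ∏ i, x i ^ ((m : Fin n → ℤ) i).toNat)
  (ψ : Multiplicative P₀ →* 𝒮 0)
  (hψ : ∀ p : P₀, ((ψ (Multiplicative.ofAdd p) : 𝒮 0) : S) =
    ∏ l, Fin.append x u l ^ ((p : Fin (n + r) → ℤ) l).toNat)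

include hP₀ in
/-- The span of any face of `ψ` lies in the exponent lattice `ker(v ↦ Σ v_l (a,b)_l)`. [folklore] -/
theorem span_face_le_ker (𝔮₀ : Ideal (𝒮 0)) :
    Submodule.span ℤ ((fun p : P₀ => (p : Fin (n + r) → ℤ)) '' LogChart.face P₀ ψ 𝔮₀) ≤
      LinearMap.ker (Fintype.linearCombination ℤ (Fin.append a b)) := by
  rw [Submodule.span_le]
  rintro _ ⟨p, -, rfl⟩
  exact ((hP₀ p).mp p.2).2

include hle hι hu huu hb hP hP₀ hφ hψ in
/-- `(0, e)` lies in the span of the face of `ψ` at `ι⁻¹𝔮` for every `e` with `Σ eⱼ bⱼ = 0`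
(write `e = e₁ − e₂` with `eᵢ ≥ 0` in the kernel; `ψ(0, eᵢ) = u^{eᵢ}` is a unit). [folklore] -/
theorem append_zero_mem_span_face (hbfin : ∀ j, IsOfFinAddOrder (b j)) (𝔮 : Ideal (𝒮' 0))
    [𝔮.IsPrime] (e : Fin r → ℤ) (he : Fintype.linearCombination ℤ b e = 0) :
    Fin.append (0 : Fin n → ℤ) e ∈
      Submodule.span ℤ ((fun p : P₀ => (p : Fin (n + r) → ℤ)) '' LogChart.face P₀ ψ (𝔮.comap ι)) := by
  -- nonnegative kernel elements give face elements
  have h0P : (0 : Fin n → ℤ) ∈ P := by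
    rw [hP]
    exact ⟨le_rfl, map_zero _⟩
  have hface : ∀ e' : Fin r → ℤ, 0 ≤ e' → Fintype.linearCombination ℤ b e' = 0 →
      Fin.append (0 : Fin n → ℤ) e' ∈
        (fun p : P₀ => (p : Fin (n + r) → ℤ)) '' LogChart.face P₀ ψ (𝔮.comap ι) := by
    intro e' he' hlc
    have hmem : Fin.append (0 : Fin n → ℤ) e' ∈ P₀ := by
      rw [hP₀]
      refine ⟨UnitChart.append_nonneg_iff.mpr ⟨le_rfl, he'⟩, ?_⟩
      rw [UnitChart.linearCombination_append, map_zero, zero_add, hlc]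
    refine ⟨⟨_, hmem⟩, ?_, rfl⟩
    rw [UnitChart.mem_face_iff 𝒮 f 𝒮' hle ι hι hu huu hb P P₀ φ hφ ψ hψ 𝔮 ⟨_, hmem⟩ ⟨0, h0P⟩
      (fun i => by simp [Fin.append_left]), LogChart.mem_face_iff]
    rw [show (⟨0, h0P⟩ : P) = 0 from rfl, ofAdd_zero, map_one]
    exact fun h => ‹𝔮.IsPrime›.ne_top ((Ideal.eq_top_iff_one 𝔮).mpr h)
  -- the decomposition `e = e₁ − e₂`
  let e₂ : Fin r → ℤ := fun j => (addOrderOf (b j) : ℤ) * |e j|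
  have he₂ : 0 ≤ e₂ := fun j => mul_nonneg (Int.natCast_nonneg _) (abs_nonneg _)
  have he₂lc : Fintype.linearCombination ℤ b e₂ = 0 := by
    rw [Fintype.linearCombination_apply]
    refine Finset.sum_eq_zero fun j _ => ?_
    change ((addOrderOf (b j) : ℤ) * |e j|) • b j = 0
    rw [mul_comm, mul_zsmul, natCast_zsmul, addOrderOf_nsmul_eq_zero, zsmul_zero]
  have he₁ : 0 ≤ e + e₂ := by
    intro j
    change 0 ≤ e j + (addOrderOf (b j) : ℤ) * |e j|
    have h1 : (1 : ℤ) ≤ addOrderOf (b j) := by exact_mod_cast (hbfin j).addOrderOf_pos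
    nlinarith [abs_nonneg (e j), neg_abs_le (e j)]
  have he₁lc : Fintype.linearCombination ℤ b (e + e₂) = 0 := by rw [map_add, he, he₂lc, add_zero]
  have heq : Fin.append (0 : Fin n → ℤ) e =
      Fin.append (0 : Fin n → ℤ) (e + e₂) - Fin.append (0 : Fin n → ℤ) e₂ := by
    funext l
    induction l using Fin.addCases with
    | left i => simp [Fin.append_left]
    | right j => simp [Fin.append_right]
  rw [heq]
  exact Submodule.sub_mem _ (Submodule.subset_span (hface _ he₁ he₁lc))
    (Submodule.subset_span (hface _ he₂ he₂lc))

include hle hι hu huu hb hP hP₀ hφ hψ in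
/-- **`rk ⟨F_ψ(ι⁻¹𝔮)⟩ = rk ⟨F_φ(𝔮)⟩ + r`.** [cite: Kato1994, Def. (2.1)] [folklore] -/
theorem finrank_span_face_eq (hbsurj : ∀ d : A, f d = 0 → ∃ j, b j = d)
    (hbfin : ∀ j, IsOfFinAddOrder (b j)) (𝔮 : Ideal (𝒮' 0)) [𝔮.IsPrime] :
    Module.finrank ℤ (Submodule.span ℤ
        ((fun p : P₀ => (p : Fin (n + r) → ℤ)) '' LogChart.face P₀ ψ (𝔮.comap ι))) =
      Module.finrank ℤ (Submodule.span ℤ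
        ((fun m : P => (m : Fin n → ℤ)) '' LogChart.face P φ 𝔮)) + r := by
  classical
  set V₀ := Submodule.span ℤ
    ((fun p : P₀ => (p : Fin (n + r) → ℤ)) '' LogChart.face P₀ ψ (𝔮.comap ι)) with hV₀
  set V := Submodule.span ℤ ((fun m : P => (m : Fin n → ℤ)) '' LogChart.face P φ 𝔮) with hV
  -- the projection to the first `n` coordinates, restricted to `V₀`
  let π : (Fin (n + r) → ℤ) →ₗ[ℤ] (Fin n → ℤ) := LinearMap.funLeft ℤ ℤ (Fin.castAdd r)
  have hπ : ∀ v i, π v i = v (Fin.castAdd r i) := fun v i => rfl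
  let g : V₀ →ₗ[ℤ] (Fin n → ℤ) := π ∘ₗ V₀.subtype
  -- (1) the image of `V₀` is `V`
  have hrange : LinearMap.range g = V := by
    rw [LinearMap.range_comp, Submodule.range_subtype, hV₀, Submodule.map_span, hV]
    congr 1
    ext m
    constructor
    · rintro ⟨_, ⟨p, hp, rfl⟩, rfl⟩
      have hm : π (p : Fin (n + r) → ℤ) ∈ P := UnitChart.proj_mem f hb P hP P₀ hP₀ p
      refine ⟨⟨_, hm⟩, ?_, rfl⟩
      exact (UnitChart.mem_face_iff 𝒮 f 𝒮' hle ι hι hu huu hb P P₀ φ hφ ψ hψ 𝔮 p ⟨_, hm⟩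
        (fun i => rfl)).mp hp
    · rintro ⟨m, hm, rfl⟩
      obtain ⟨p, j₀, hpm, -⟩ := UnitChart.exists_lift f P hP P₀ hP₀ hbsurj m
      refine ⟨(p : Fin (n + r) → ℤ), ⟨p, ?_, rfl⟩, funext fun i => hpm i⟩
      exact (UnitChart.mem_face_iff 𝒮 f 𝒮' hle ι hι hu huu hb P P₀ φ hφ ψ hψ 𝔮 p m hpm).mpr hm
  -- (2) the kernel of `g` has rank `r`: it projects isomorphically onto `ker(e ↦ Σ eⱼ bⱼ)`
  let ρ : (Fin (n + r) → ℤ) →ₗ[ℤ] (Fin r → ℤ) := LinearMap.funLeft ℤ ℤ (Fin.natAdd n)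
  have hρ : ∀ v j, ρ v j = v (Fin.natAdd n j) := fun v j => rfl
  let h : LinearMap.ker g →ₗ[ℤ] (Fin r → ℤ) := ρ ∘ₗ (V₀.subtype ∘ₗ (LinearMap.ker g).subtype)
  have hh : ∀ v j, h v j = ((v : V₀) : Fin (n + r) → ℤ) (Fin.natAdd n j) := fun v j => rfl
  have hker0 : ∀ (v : LinearMap.ker g) (i : Fin n), ((v : V₀) : Fin (n + r) → ℤ) (Fin.castAdd r i) = 0 := by
    intro v i
    have hv : g v = 0 := v.2
    exact congrFun hv i
  have hdecomp : ∀ v : LinearMap.ker g,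
      ((v : V₀) : Fin (n + r) → ℤ) = Fin.append (0 : Fin n → ℤ) (h v) := by
    intro v
    funext l
    induction l using Fin.addCases with
    | left i => rw [Fin.append_left, hker0]; rfl
    | right j => rw [Fin.append_right, hh]
  have hinj : Function.Injective h := by
    intro v v' hvv'
    apply Subtype.ext; apply Subtype.ext
    rw [hdecomp v, hdecomp v', hvv']
  have hrangeh : LinearMap.range h = LinearMap.ker (Fintype.linearCombination ℤ b) := by
    apply le_antisymm
    · rintro _ ⟨v, rfl⟩
      rw [LinearMap.mem_ker]
      have hv : ((v : V₀) : Fin (n + r) → ℤ) ∈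
          LinearMap.ker (Fintype.linearCombination ℤ (Fin.append a b)) :=
        span_face_le_ker 𝒮 P₀ hP₀ ψ (𝔮.comap ι) (v : V₀).2
      rw [LinearMap.mem_ker, hdecomp v, UnitChart.linearCombination_append, map_zero,
        zero_add] at hv
      exact hv
    · intro e he
      rw [LinearMap.mem_ker] at he
      have hmem := append_zero_mem_span_face 𝒮 f 𝒮' hle ι hι hu huu hb P hP P₀ hP₀ φ hφ ψ hψ
        hbfin 𝔮 e he
      have hkg : (⟨_, hmem⟩ : V₀) ∈ LinearMap.ker g := by
        rw [LinearMap.mem_ker]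
        funext i
        change Fin.append (0 : Fin n → ℤ) e (Fin.castAdd r i) = 0
        rw [Fin.append_left]; rfl
      refine ⟨⟨_, hkg⟩, funext fun j => ?_⟩
      rw [hh]
      exact Fin.append_right _ _ j
  have hker : Module.finrank ℤ (LinearMap.ker g) = r := by
    rw [← LinearMap.finrank_range_of_inj hinj, hrangeh,
      KernelLattice.finrank_ker_linearCombination b hbfin]
  -- (3) rank–nullity on `g`
  have hrn := Submodule.finrank_quotient_add_finrank (LinearMap.ker g)
  rw [LinearEquiv.finrank_eq g.quotKerEquivRange, hrange, hker] at hrn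
  exact hrn.symm

include hle hι hu huu hb hP hP₀ hφ hψ in
/-- **The rank terms of Kato's (2.1)(ii) agree**: `(n + r) − rk ⟨F_ψ(ι⁻¹𝔮)⟩ = n − rk ⟨F_φ(𝔮)⟩`.
[cite: Kato1994, Def. (2.1)] -/
theorem rank_term_eq (hbsurj : ∀ d : A, f d = 0 → ∃ j, b j = d)
    (hbfin : ∀ j, IsOfFinAddOrder (b j)) (𝔮 : Ideal (𝒮' 0)) [𝔮.IsPrime] :
    (n + r) - Module.finrank ℤ (Submodule.span ℤ
        ((fun p : P₀ => (p : Fin (n + r) → ℤ)) '' LogChart.face P₀ ψ (𝔮.comap ι))) =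
      n - Module.finrank ℤ (Submodule.span ℤ
        ((fun m : P => (m : Fin n → ℤ)) '' LogChart.face P φ 𝔮)) := by
  rw [finrank_span_face_eq 𝒮 f 𝒮' hle ι hι hu huu hb P hP P₀ hP₀ φ hφ ψ hψ hbsurj hbfin 𝔮,
    Nat.add_sub_add_right]

end Summit.ResolutionOfSingularities.ResolutionOfSingularities.Theorems.FRationalResolution.UnitChartRank

end
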